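import Summits.AtomisticToContinuum.HydrodynamicLimit.Theorems.LambertianContactSwapContactAngleEquidistributionCentring
import Literature.MathematicalPhysics.KineticTheory.HardSphereCollisionCampbell
import Summits.AtomisticToContinuum.HydrodynamicLimit.Theorems.JParityClosureOddContactSymmetryGibbsInvariance
import Literature.Analysis.FluidPDE.ConfinedHardSphereFlowShortBad
import Literature.Analysis.FluidPDE.BBGKYMarginals
import HarnessLib

/-!
# Fibrewise exactness of the cosine-law centring in midpoint coordinates
# (stub `stub_fibreCentring` of line `Sketch` v4, crux `LambertianContactSwap.ContactAngleEquidistribution`,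
# stmt-AtomisticToContinuum-12097)

Support file (`--supports`) for the lead's exact equilibrium centring of the ISOLATED stratum
(skeleton v4 of line `Sketch`). After Campbell's formula and the change of variables of the
outgoing contact flux to incoming midpoint / normal coordinates (CIP 1994 App. 4.A pp. 107–111;
tree: `stub_campbellTimeDep`, `stub_fluxMidpoint`), the equilibrium mean of the isolated
(no third centre within `3ε` of the contact midpoint), speed-capped, `κ_g`-centred,
`|g|²`-weighted contact-angle functional is a time integral of `Σ_{i≠j} ∫ dz` of the difference of
the two sphere integrals of `stub_fibreCentring` (positive and negative parts of the real mark, read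
on the fibre `ω ↦ mid ω`: particle `i` at `c + (ε/2)ω`, particle `j` at `c − (ε/2)ω`, `c = x_j`,
velocities unchanged).

WHY the two sphere integrals agree, for EVERY `z` (this file):

* on the fibre the separation of the pair is exactly `εω` (the vector `εω` lies in the open cube,
  `Torus.reprSym_add_proj`), so the contact midpoint is `c` and the unit normal is `ω`;
* hence the midpoint-ball selector `near`, the speed cap, and — off `near` — the hard-core
  indicator `1_D` (torus triangle inequality: a third centre farther than `3ε` from `c` is farther
  than `ε` from `c ± (ε/2)ω`) do not depend on `ω`;
* the homogeneous Gibbs weight depends on the configuration only through the velocities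
  (`tensorPow_localGibbsProfile_const`), which the fibre does not move;
* what is left is `W(z) ∫_{S²} (ε²⟪ω, −g⟫)₊ (|g|² m(ω))^± dω` with
  `m(ω) = ψ(ω) − ∫ ψ(lambertDir(−g) ξ) dγ(ξ)`, and the two signs have the same mass because the real
  integral `∫ ⟪ω, −ĝ⟫₊ m(ω) dω` vanishes — the `κ_g`-centring identity of the tree
  (`integral_cosFlux_sub_avg_eq_zero_of_ne_zero`, p107962).

References: C. Cercignani, R. Illner, M. Pulvirenti, *The Mathematical Theory of Dilute Gases*,
Springer (1994), App. 4.A pp. 107–111 (contact coordinates); the centring identity is the tree's.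
-/

noncomputable section

open MeasureTheory Filter Set Topology ProbabilityTheory
open scoped ENNReal BigOperators Classical RealInnerProductSpace

namespace Summit.AtomisticToContinuum.HydrodynamicLimit.Theorems.ContactAngleEquidistributionSketch

open Literature.Analysis.FluidPDE Literature.MathematicalPhysics.KineticTheory

/-! ### Two facts on the minimal image of the torus -/

section TorusGeometry

variable {d : Type*} [Fintype d]

/-- Two translates of the same point of the torus by vectors `a`, `b` with `‖a − b‖ < 1/2` have
minimal-image separation exactly `a − b` (the minimal image is additive in the open cube,
`Torus.reprSym_add_proj`). [folklore] -/
theorem fibre_sepVec_add_proj_add_proj {c : UnitAddTorus d} {a b : EuclideanSpace ℝ d}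
    (h : ‖a - b‖ < 1 / 2) :
    (Torus.geometry d).sepVec (c + Literature.Analysis.FunctionSpaces.Torus.proj a)
      (c + Literature.Analysis.FunctionSpaces.Torus.proj b) = a - b := by
  rw [Torus.geometry_sepVec, add_sub_add_left_eq_sub, sub_eq_add_neg _ (_root_.Literature.Analysis.FunctionSpaces.Torus.proj b),
    ← Literature.Analysis.FunctionSpaces.Torus.proj_neg,
    ← Literature.Analysis.FunctionSpaces.Torus.proj_add, ← sub_eq_add_neg]
  have key := Torus.reprSym_add_proj_of_norm_lt (x := (0 : UnitAddTorus d)) (s := a - b)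
    (by rwa [Torus.reprSym_zero, norm_zero, zero_add])
  rwa [zero_add, Torus.reprSym_zero, zero_add] at key

/-- A centre farther than `3ε` from `c` is at least `ε` away from every translate `c + a`,
`‖a‖ ≤ ε/2`, in both orders of the pair (torus triangle inequality). [folklore] -/
theorem fibre_le_norm_sepVec_of_far {ε : ℝ} (hε0 : 0 ≤ ε) {x c : UnitAddTorus d}
    (hx : 3 * ε < ‖(Torus.geometry d).sepVec x c‖) {a : EuclideanSpace ℝ d} (ha : ‖a‖ ≤ ε / 2) :
    ε ≤ ‖(Torus.geometry d).sepVec x (c + Literature.Analysis.FunctionSpaces.Torus.proj a)‖ ∧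
      ε ≤ ‖(Torus.geometry d).sepVec (c + Literature.Analysis.FunctionSpaces.Torus.proj a) x‖ := by
  have h1 : ‖(Torus.geometry d).sepVec x c‖ ≤
      ‖(Torus.geometry d).sepVec x (c + Literature.Analysis.FunctionSpaces.Torus.proj a)‖ + ‖a‖ := by
    have h := Torus.euclidDist_le_euclidDist_translate x c 0 a
    rwa [Literature.Analysis.FunctionSpaces.Torus.proj_zero, add_zero, zero_sub, norm_neg] at h
  have h2 : ε ≤ ‖(Torus.geometry d).sepVec x (c + Literature.Analysis.FunctionSpaces.Torus.proj a)‖ := by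
    linarith
  refine ⟨h2, ?_⟩
  rwa [Torus.norm_geometry_sepVec, Torus.euclidDist_comm] at h2

end TorusGeometry

/-! ### Positive and negative parts of a centred cosine flux -/

/-- If a real integrable function has integral zero, the lower integrals of its positive and of its
negative part coincide. [folklore] -/
theorem fibre_lintegral_ofReal_eq_lintegral_ofReal_neg {α : Type*} [MeasurableSpace α] {μ : Measure α}
    {F : α → ℝ} (hF : Integrable F μ) (h0 : ∫ x, F x ∂μ = 0) :
    ∫⁻ x, ENNReal.ofReal (F x) ∂μ = ∫⁻ x, ENNReal.ofReal (-F x) ∂μ := by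
  have h := integral_eq_lintegral_pos_part_sub_lintegral_neg_part hF
  rw [h0] at h
  have hfin : ∀ {G : α → ℝ}, Integrable G μ → ∫⁻ x, ENNReal.ofReal (G x) ∂μ ≠ ∞ := fun hG =>
    ((lintegral_ofReal_le_lintegral_enorm _).trans_lt (hasFiniteIntegral_iff_enorm.1 hG.2)).ne
  exact (ENNReal.toReal_eq_toReal_iff' (hfin hF) (hfin hF.fun_neg)).1 (by linarith)

/-- **The cosine flux of a `κ_g`-centred bounded mark has positive and negative parts of equal mass.**
For `g : V3`, a bounded measurable real mark `f` and `a ≥ 0`,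
`∫⁻_{S²} (a⟪ω, −g⟫)₊ (|g|² m(ω))⁺ dω = ∫⁻_{S²} (a⟪ω, −g⟫)₊ (|g|² m(ω))⁻ dω`,
`m(ω) = f ω − ∫ f(lambertDir(−g) ξ) dγ(ξ)`: both sides are `ofReal` of integrable functions whose
difference `a|g|³ ⟪ω, −ĝ⟫₊ m(ω)` integrates to `0` by the centring identity
`integral_cosFlux_sub_avg_eq_zero_of_ne_zero`; for `g = 0` both vanish. [folklore] -/
theorem fibre_lintegral_cosFlux_mark_pos_eq_neg {g : V3} {f : V3 → ℝ} (hfm : Measurable f) {C : ℝ}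
    (hfb : ∀ x, |f x| ≤ C) {a : ℝ} (ha : 0 ≤ a) :
    ∫⁻ ω : Metric.sphere (0 : V3) 1, ENNReal.ofReal (a * ⟪(ω : V3), -g⟫) *
        ENNReal.ofReal (‖g‖ ^ 2 * (f ω - ∫ ξ, f (lambertDir (-g) ξ) ∂(stdGaussian V3)))
      ∂(volume : Measure V3).toSphere =
    ∫⁻ ω : Metric.sphere (0 : V3) 1, ENNReal.ofReal (a * ⟪(ω : V3), -g⟫) *
        ENNReal.ofReal (-(‖g‖ ^ 2 * (f ω - ∫ ξ, f (lambertDir (-g) ξ) ∂(stdGaussian V3))))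
      ∂(volume : Measure V3).toSphere := by
  by_cases hg : g = 0
  · subst hg
    simp
  have hgn : 0 < ‖g‖ := norm_pos_iff.2 hg
  set A : ℝ := ∫ ξ, f (lambertDir (-g) ξ) ∂(stdGaussian V3) with hA
  have hν : ‖-(‖g‖⁻¹ • g)‖ = 1 := by
    rw [norm_neg, norm_smul, Real.norm_of_nonneg (inv_nonneg.2 hgn.le), inv_mul_cancel₀ hgn.ne']
  -- the cosine weight `(a⟪ω, -g⟫)₊ = a‖g‖ ⟪ω, -ĝ⟫₊` inside `ofReal`
  have hcos : ∀ ω : Metric.sphere (0 : V3) 1, ENNReal.ofReal (a * ⟪(ω : V3), -g⟫) =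
      ENNReal.ofReal (a * ‖g‖ * max ⟪(ω : V3), -(‖g‖⁻¹ • g)⟫ 0) := by
    intro ω
    have h1 : ⟪(ω : V3), -g⟫ = ‖g‖ * ⟪(ω : V3), -(‖g‖⁻¹ • g)⟫ := by
      rw [inner_neg_right, inner_neg_right, inner_smul_right, mul_neg, ← mul_assoc,
        mul_inv_cancel₀ hgn.ne', one_mul]
    rw [h1, ← mul_assoc]
    rcases le_total 0 ⟪(ω : V3), -(‖g‖⁻¹ • g)⟫ with h | h
    · rw [max_eq_left h]
    · rw [max_eq_right h, mul_zero, ENNReal.ofReal_zero,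
        ENNReal.ofReal_of_nonpos (mul_nonpos_of_nonneg_of_nonpos (mul_nonneg ha hgn.le) h)]
  have hK : 0 ≤ a * ‖g‖ := mul_nonneg ha hgn.le
  have hw := measurable_posInner_sphere (-(‖g‖⁻¹ • g))
  have hint : Integrable (fun ω : Metric.sphere (0 : V3) 1 =>
      max ⟪(ω : V3), -(‖g‖⁻¹ • g)⟫ 0 * (f ω - A)) (volume.toSphere) :=
    Integrable.of_bound (hw.mul ((hfm.comp continuous_subtype_val.measurable).sub_const A)).aestronglyMeasurable
      (C + |A|) (Eventually.of_forall fun ω => by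
        rw [norm_mul, Real.norm_of_nonneg (le_max_right _ _), Real.norm_eq_abs]
        calc max ⟪(ω : V3), -(‖g‖⁻¹ • g)⟫ 0 * |f ω - A| ≤ 1 * (C + |A|) :=
              mul_le_mul (posInner_sphere_le_one hν ω)
                ((abs_sub _ _).trans (add_le_add_left (hfb _) _)) (abs_nonneg _) zero_le_one
          _ = C + |A| := one_mul _)
  have hL : ∀ ω : Metric.sphere (0 : V3) 1,
      ENNReal.ofReal (a * ⟪(ω : V3), -g⟫) * ENNReal.ofReal (‖g‖ ^ 2 * (f ω - A)) =
        ENNReal.ofReal (a * ‖g‖ * ‖g‖ ^ 2 * (max ⟪(ω : V3), -(‖g‖⁻¹ • g)⟫ 0 * (f ω - A))) := by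
    intro ω
    rw [hcos ω, ← ENNReal.ofReal_mul (mul_nonneg hK (le_max_right _ _))]
    congr 1
    ring
  have hR : ∀ ω : Metric.sphere (0 : V3) 1,
      ENNReal.ofReal (a * ⟪(ω : V3), -g⟫) * ENNReal.ofReal (-(‖g‖ ^ 2 * (f ω - A))) =
        ENNReal.ofReal (-(a * ‖g‖ * ‖g‖ ^ 2 * (max ⟪(ω : V3), -(‖g‖⁻¹ • g)⟫ 0 * (f ω - A)))) := by
    intro ω
    rw [hcos ω, ← ENNReal.ofReal_mul (mul_nonneg hK (le_max_right _ _))]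
    congr 1
    ring
  rw [lintegral_congr hL, lintegral_congr hR]
  refine fibre_lintegral_ofReal_eq_lintegral_ofReal_neg (hint.const_mul _) ?_
  rw [integral_const_mul, integral_cosFlux_sub_avg_eq_zero_of_ne_zero hg hfm hfb, mul_zero]

/-! ### The stub -/

/-- **Fibrewise exactness of the `κ_g`-centring in midpoint coordinates** (stub `stub_fibreCentring`
of line `Sketch` v4). For `0 < ε < 1/2`, `i ≠ j`, an admissible mark `ψ` (jointly measurable,
`|ψ| ≤ 1`) and EVERY configuration `z`, the sphere integrals over the normal `ω` of the cosine flux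
`(ε²⟪ω, v_j − v_i⟫)₊` times `1_D ρ (mark)^±` read on the fibre `mid ω` (particle `i` at
`x_j + (ε/2)ω`, particle `j` at `x_j − (ε/2)ω`, velocities unchanged) coincide: on the fibre the pair
separation is `εω`, so the contact midpoint is `x_j`, the midpoint-ball selector, the speed cap, the
hard-core indicator off the ball and the homogeneous Gibbs weight are all `ω`-free, and the remaining
`ω`-integral is the `κ_g`-centring identity (`integral_cosFlux_sub_avg_eq_zero_of_ne_zero`).
[cite: CIP1994, App. 4.A pp. 107–111] -/
theorem stub_fibreCentring {n : ℕ} {ε : ℝ} (hε0 : 0 < ε) (hε : ε < 1 / 2) {i j : Fin n} (hij : i ≠ j)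
    (θe s V : ℝ) (ψ : ℝ → T3 → V3 → V3 → V3 → ℝ)
    (hψm : Measurable fun p : ℝ × T3 × V3 × V3 × V3 => ψ p.1 p.2.1 p.2.2.1 p.2.2.2.1 p.2.2.2.2)
    (hψb : ∀ s x v w m, |ψ s x v w m| ≤ 1) (z : Config n (Fin 3) T3) :
    let G := Torus.geometry (Fin 3)
    let ldir : V3 → V3 → V3 := fun ω ξ => ‖‖ω‖⁻¹ • ω + ‖ξ‖⁻¹ • ξ‖⁻¹ • (‖ω‖⁻¹ • ω + ‖ξ‖⁻¹ • ξ)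
    let xmid : Config n (Fin 3) T3 → T3 := fun y => G.translate (y j).1 ((2 : ℝ)⁻¹ • G.sepVec (y i).1 (y j).1)
    let near : Config n (Fin 3) T3 → Prop := fun y =>
      ∃ k : Fin n, k ≠ i ∧ k ≠ j ∧ ‖G.sepVec (y k).1 (xmid y)‖ ≤ 3 * ε
    let mark : Config n (Fin 3) T3 → ℝ := fun y =>
      if near y then 0 else if V < ‖(y i).2 - (y j).2‖ then 0 else
        ‖(y i).2 - (y j).2‖ ^ 2 * (ψ s (xmid y) (y i).2 (y j).2 (ε⁻¹ • G.sepVec (y i).1 (y j).1) -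
          ∫ ξ, ψ s (xmid y) (y i).2 (y j).2 (ldir (-((y i).2 - (y j).2)) ξ) ∂(stdGaussian V3))
    let ρ : Config n (Fin 3) T3 → ℝ≥0∞ := fun y =>
      ENNReal.ofReal (canonicalDensity G ε n (localGibbsProfile (fun _ => 1) (fun _ => 0) (fun _ => θe)) y)
    let mid : V3 → Config n (Fin 3) T3 := fun ω =>
      Function.update (Function.update z i
          ((z j).1 + Literature.Analysis.FunctionSpaces.Torus.proj ((ε / 2) • ω), (z i).2)) j
        ((z j).1 + Literature.Analysis.FunctionSpaces.Torus.proj (-((ε / 2) • ω)), (z j).2)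
    ∫⁻ ω : Metric.sphere (0 : V3) 1,
        ENNReal.ofReal (ε ^ (Fintype.card (Fin 3) - 1) * ⟪((ω : V3)), (z j).2 - (z i).2⟫) *
          (hardSphereDomain G n ε).indicator (fun y => ρ y * ENNReal.ofReal (mark y)) (mid ω)
        ∂(volume : Measure V3).toSphere =
      ∫⁻ ω : Metric.sphere (0 : V3) 1,
        ENNReal.ofReal (ε ^ (Fintype.card (Fin 3) - 1) * ⟪((ω : V3)), (z j).2 - (z i).2⟫) *
          (hardSphereDomain G n ε).indicator (fun y => ρ y * ENNReal.ofReal (-mark y)) (mid ω)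
        ∂(volume : Measure V3).toSphere := by
  intro G ldir xmid near mark ρ mid
  /- (0) reading the fibre configuration `mid ω` -/
  have hmi : ∀ w : V3, mid w i =
      ((z j).1 + Literature.Analysis.FunctionSpaces.Torus.proj ((ε / 2) • w), (z i).2) := fun w => by
    show Function.update (Function.update z i _) j _ i = _
    rw [Function.update_of_ne hij, Function.update_self]
  have hmj : ∀ w : V3, mid w j =
      ((z j).1 + Literature.Analysis.FunctionSpaces.Torus.proj (-((ε / 2) • w)), (z j).2) := fun w => by
    show Function.update (Function.update z i _) j _ j = _
    rw [Function.update_self]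
  have hmk : ∀ (w : V3) (k : Fin n), k ≠ i → k ≠ j → mid w k = z k := fun w k hki hkj => by
    show Function.update (Function.update z i _) j _ k = z k
    rw [Function.update_of_ne hkj, Function.update_of_ne hki]
  have hmv : ∀ (w : V3) (k : Fin n), (mid w k).2 = (z k).2 := fun w k => by
    by_cases hki : k = i
    · rw [hki, hmi]
    · by_cases hkj : k = j
      · rw [hkj, hmj]
      · rw [hmk w k hki hkj]
  /- (1) on the fibre the pair separation is `εω` and the contact midpoint is `x_j` -/
  have hω1 : ∀ ω : Metric.sphere (0 : V3) 1, ‖(ω : V3)‖ = 1 := fun ω => norm_eq_of_mem_sphere ω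
  have hab : ∀ ω : Metric.sphere (0 : V3) 1,
      (ε / 2) • (ω : V3) - -((ε / 2) • (ω : V3)) = ε • (ω : V3) := fun ω => by
    rw [sub_neg_eq_add, ← add_smul, add_halves]
  have hsep : ∀ ω : Metric.sphere (0 : V3) 1, G.sepVec (mid ω i).1 (mid ω j).1 = ε • (ω : V3) := by
    intro ω
    rw [hmi, hmj, ← hab ω]
    exact fibre_sepVec_add_proj_add_proj
      (by rw [hab, norm_smul, Real.norm_of_nonneg hε0.le, hω1, mul_one]; exact hε)
  have hεn : ∀ ω : Metric.sphere (0 : V3) 1, ‖G.sepVec (mid ω i).1 (mid ω j).1‖ = ε := fun ω => by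
    rw [hsep ω, norm_smul, Real.norm_of_nonneg hε0.le, hω1, mul_one]
  have hεn' : ∀ ω : Metric.sphere (0 : V3) 1, ‖G.sepVec (mid ω j).1 (mid ω i).1‖ = ε := fun ω => by
    rw [← hεn ω]
    exact Torus.euclidDist_comm _ _
  have hxmid : ∀ ω : Metric.sphere (0 : V3) 1, xmid (mid ω) = (z j).1 := by
    intro ω
    show G.translate (mid ω j).1 ((2 : ℝ)⁻¹ • G.sepVec (mid ω i).1 (mid ω j).1) = (z j).1
    rw [hsep ω, hmj]
    show (z j).1 + Literature.Analysis.FunctionSpaces.Torus.proj (-((ε / 2) • (ω : V3))) +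
      Literature.Analysis.FunctionSpaces.Torus.proj ((2 : ℝ)⁻¹ • (ε • (ω : V3))) = (z j).1
    have h2 : -((ε / 2) • (ω : V3)) + (2 : ℝ)⁻¹ • (ε • (ω : V3)) = 0 := by
      rw [smul_smul, show (2 : ℝ)⁻¹ * ε = ε / 2 by ring, neg_add_cancel]
    rw [add_assoc, ← Literature.Analysis.FunctionSpaces.Torus.proj_add, h2,
      Literature.Analysis.FunctionSpaces.Torus.proj_zero, add_zero]
  /- (2) the midpoint-ball selector is `ω`-free -/
  have hnear : ∀ ω : Metric.sphere (0 : V3) 1,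
      near (mid ω) ↔ ∃ k : Fin n, k ≠ i ∧ k ≠ j ∧ ‖G.sepVec (z k).1 (z j).1‖ ≤ 3 * ε := by
    intro ω
    show (∃ k : Fin n, k ≠ i ∧ k ≠ j ∧ ‖G.sepVec (mid ω k).1 (xmid (mid ω))‖ ≤ 3 * ε) ↔ _
    rw [hxmid ω]
    exact exists_congr fun k => ⟨fun ⟨hki, hkj, hk⟩ => ⟨hki, hkj, by rwa [hmk _ k hki hkj] at hk⟩,
      fun ⟨hki, hkj, hk⟩ => ⟨hki, hkj, by rwa [hmk _ k hki hkj]⟩⟩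
  /- (3) the mark on the fibre, off the ball -/
  have hmark : ∀ ω : Metric.sphere (0 : V3) 1, ¬ near (mid ω) → mark (mid ω) =
      if V < ‖(z i).2 - (z j).2‖ then 0 else ‖(z i).2 - (z j).2‖ ^ 2 *
        (ψ s (z j).1 (z i).2 (z j).2 ω -
          ∫ ξ, ψ s (z j).1 (z i).2 (z j).2 (lambertDir (-((z i).2 - (z j).2)) ξ) ∂(stdGaussian V3)) := by
    intro ω hn
    show (if near (mid ω) then (0 : ℝ) else _) = _
    rw [if_neg hn, hxmid ω, hsep ω, inv_smul_smul₀ hε0.ne', hmi, hmj]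
    rfl
  /- (4) the two zero cases: a third centre in the ball, or a fast pair -/
  by_cases hz0 : (∃ k : Fin n, k ≠ i ∧ k ≠ j ∧ ‖G.sepVec (z k).1 (z j).1‖ ≤ 3 * ε) ∨
      V < ‖(z i).2 - (z j).2‖
  · have hm0 : ∀ ω : Metric.sphere (0 : V3) 1, mark (mid ω) = 0 := fun ω => by
      by_cases hn : near (mid ω)
      · exact if_pos hn
      · rw [hmark ω hn]
        rcases hz0 with hnz | hV
        · exact absurd ((hnear ω).2 hnz) hn
        · exact if_pos hV
    refine lintegral_congr fun ω => ?_
    simp only [Set.indicator_apply, hm0 ω, neg_zero]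
  push Not at hz0
  obtain ⟨hfar, hVle⟩ := hz0
  have hn : ∀ ω : Metric.sphere (0 : V3) 1, ¬ near (mid ω) := fun ω h => by
    obtain ⟨k, hki, hkj, hk⟩ := (hnear ω).1 h
    exact (not_le.2 (hfar k hki hkj)) hk
  have hm1 : ∀ ω : Metric.sphere (0 : V3) 1, mark (mid ω) = ‖(z i).2 - (z j).2‖ ^ 2 *
      (ψ s (z j).1 (z i).2 (z j).2 ω -
        ∫ ξ, ψ s (z j).1 (z i).2 (z j).2 (lambertDir (-((z i).2 - (z j).2)) ξ) ∂(stdGaussian V3)) :=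
    fun ω => by rw [hmark ω (hn ω), if_neg (not_lt.2 hVle)]
  /- (5) off the ball the hard-core constraint on the fibre is `ω`-free -/
  have hD : ∀ ω : Metric.sphere (0 : V3) 1, mid ω ∈ hardSphereDomain G n ε ↔
      ∀ k l : Fin n, k ≠ l → k ≠ i → k ≠ j → l ≠ i → l ≠ j → ε ≤ ‖G.sepVec (z k).1 (z l).1‖ := by
    intro ω
    rw [mem_hardSphereDomain]
    refine ⟨fun h k l hkl hki hkj hli hlj => ?_, fun h k l hkl => ?_⟩
    · have h' := h k l hkl
      rwa [hmk _ k hki hkj, hmk _ l hli hlj] at h'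
    · have ha : ‖(ε / 2) • (ω : V3)‖ ≤ ε / 2 := by
        rw [norm_smul, Real.norm_of_nonneg (by positivity), hω1, mul_one]
      have ha' : ‖-((ε / 2) • (ω : V3))‖ ≤ ε / 2 := by rw [norm_neg]; exact ha
      by_cases hki : k = i
      · rw [hki] at hkl ⊢
        by_cases hlj : l = j
        · rw [hlj, hεn ω]
        · have hli : l ≠ i := fun h => hkl h.symm
          rw [hmi, hmk _ l hli hlj]
          exact (fibre_le_norm_sepVec_of_far hε0.le (hfar l hli hlj) ha).2
      · by_cases hkj : k = j
        · rw [hkj] at hkl ⊢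
          by_cases hli : l = i
          · rw [hli, hεn' ω]
          · have hlj : l ≠ j := fun h => hkl h.symm
            rw [hmj, hmk _ l hli hlj]
            exact (fibre_le_norm_sepVec_of_far hε0.le (hfar l hli hlj) ha').2
        · rw [hmk _ k hki hkj]
          by_cases hli : l = i
          · rw [hli, hmi]
            exact (fibre_le_norm_sepVec_of_far hε0.le (hfar k hki hkj) ha).1
          · by_cases hlj : l = j
            · rw [hlj, hmj]
              exact (fibre_le_norm_sepVec_of_far hε0.le (hfar k hki hkj) ha').1
            · rw [hmk _ l hli hlj]
              exact h k l hkl hki hkj hli hlj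
  by_cases hP : ∀ k l : Fin n, k ≠ l → k ≠ i → k ≠ j → l ≠ i → l ≠ j → ε ≤ ‖G.sepVec (z k).1 (z l).1‖
  · /- (6) the isolated, admissible fibre: pull out the `ω`-free Gibbs weight and centre -/
    have hin : ∀ ω : Metric.sphere (0 : V3) 1, mid ω ∈ hardSphereDomain G n ε := fun ω => (hD ω).2 hP
    obtain ⟨W, hW⟩ : ∃ W : ℝ≥0∞, W = ENNReal.ofReal ((canonicalPartition G ε n
        (localGibbsProfile (fun _ => 1) (fun _ => 0) (fun _ => θe)))⁻¹ *
          tensorPow n (localGibbsProfile (fun _ => 1) (fun _ => 0) (fun _ => θe)) z) := ⟨_, rfl⟩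
    have hWtop : W ≠ ∞ := hW ▸ ENNReal.ofReal_ne_top
    have hρ : ∀ ω : Metric.sphere (0 : V3) 1, ρ (mid ω) = W := fun ω => by
      rw [hW]
      show ENNReal.ofReal (canonicalDensity G ε n _ (mid ω)) = _
      rw [canonicalDensity, Set.indicator_of_mem (hin ω), tensorPow_localGibbsProfile_const,
        tensorPow_localGibbsProfile_const]
      simp only [hmv]
    have hind : ∀ (ω : Metric.sphere (0 : V3) 1) (F : Config n (Fin 3) T3 → ℝ≥0∞),
        (hardSphereDomain G n ε).indicator F (mid ω) = F (mid ω) := fun ω F =>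
      Set.indicator_of_mem (hin ω) F
    have hcomm : ∀ x y : ℝ≥0∞, x * (W * y) = W * (x * y) := fun x y => mul_left_comm x W y
    have hf : Measurable fun m : V3 => ψ s (z j).1 (z i).2 (z j).2 m := by
      have hg : Measurable fun m : V3 => (s, (z j).1, (z i).2, (z j).2, m) := by fun_prop
      exact hψm.comp hg
    simp only [hind, hρ, hm1, hcomm]
    rw [lintegral_const_mul' W _ hWtop, lintegral_const_mul' W _ hWtop, ← neg_sub (z i).2 (z j).2]
    congr 1
    exact fibre_lintegral_cosFlux_mark_pos_eq_neg (g := (z i).2 - (z j).2)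
      (f := fun m => ψ s (z j).1 (z i).2 (z j).2 m) hf (hψb s (z j).1 (z i).2 (z j).2)
      (pow_nonneg hε0.le _)
  · /- (7) the fibre violates an `ω`-free hard-core constraint: both sides vanish -/
    have hout : ∀ ω : Metric.sphere (0 : V3) 1, mid ω ∉ hardSphereDomain G n ε := fun ω h =>
      hP ((hD ω).1 h)
    refine lintegral_congr fun ω => ?_
    rw [Set.indicator_of_notMem (hout ω), Set.indicator_of_notMem (hout ω)]

end Summit.AtomisticToContinuum.HydrodynamicLimit.Theorems.ContactAngleEquidistributionSketch

end
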